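import Mathlib.Data.Nat.Choose.Sum
import Summits.CriticalPhenomena.PercolationContinuityZ3.Theorems.PercNearOneGluingNoHeavyLowerTailSahiCTCNcGen

/-!
# `NoHeavyLowerTail` (crux stmt-CriticalPhenomena-4575), P3 lane: the SIGNATURE CALCULUS of `X_c := Π·e_c − Θ_{c−1}·D_c`
# (coefficients of the row-(a) polynomial of the level-`c` threshold certificate at every profile, any ground type)

Support file (cell `prim-l12`, seat P3, gen 22; `--supports stmt-CriticalPhenomena-4575`).  No `sorry`, no named facts, standard
axioms.  Memo `run/shared/lean/prim/prim-l12/FROM-prim-l12-p3-g22-*.md`; g21 memo §8 for the programme (row (a)_c for every `k`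
from a Pólya certificate `Π·X_c ∈ ℕ[r]`, `…SahiAllButCPolya`).

Row (a) of the level-`c` certificate `ρ_c = μ(· | exactly c closed)` (`…SahiAllButC.rhoCert_allBut`) is the value inequality
`Θ_c·D_c ≤ (Π + D_c)·e_c` at the odds, and `(Π + D_c)·e_c − Θ_c·D_c = Π·e_c − Θ_{c−1}·D_c =: X_c` (`…aPolyC_eq`).  THIS FILE computes
the coefficients of `X_c` in closed form, the input of the companion `…SahiAllButThreeRowA` (which proves `Π·X₃ ∈ ℕ[r]`):

* `posN c w d = [d ≤ c]·C(w, c − d)`, `negN c w d = Σ_{i < c − d} [c < d + (w − i)]·C(w, i)`, `sigB c w d = posN − negN` (as an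
  integer): the numbers of unconstrained profile pairs `(P, S)` (`P ∩ S = D`, `P ∪ S = N`, `#D = d`, `#(N ∖ D) = w`) with `#S = c`,
  resp. with `#P ≤ c − 1` and `#S ≥ c + 1` (`i = #(P ∖ D)`);
* `card_pairs_univ_eq` : unconstrained profile pairs ↔ subsets `T = P ∖ D` of the single points `N ∖ D` (`#P = #D + #T`,
  `#S = #N − #T`); `card_pairs_univ_swap`; `card_pairs_pos`, `card_pairs_neg` (via `Finset.sum_powerset_apply_card`);
* `coeff_PiE_sub_ThD` : **the coefficient of `X_{c'+1}` at a profile `m` is `sigB (c'+1) w d` if `m ≤ 2` pointwise (`w` single,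
  `d` doubled points of `m`) and `0` otherwise**;
* `ind_le_iff_subset_support`, `tsub_ind_apply`, `signature_tsub_ind` : for `n ≤ 2` pointwise and any `P`, the sub-profile
  `n − 1_P` (the profiles met when one factor `Π` is peeled off `Π·X_c`, `coeff_gf_mul`) has doubled points `V₂ ∖ P` and
  `#single points = #(V₁ ∖ P) + #(V₂ ∩ P)` (`V₂ = dbl n`, `V₁ = supp n ∖ V₂`).
Nothing is asserted about the crux; no positivity statement is made here.
-/

noncomputable section

open scoped Classical

namespace Summit.CriticalPhenomena.PercolationContinuityZ3.Theorems

namespace SahiAllButC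

open Finset MvPolynomial
open SahiCTCForms SahiCTCGenFun SahiCTCWeightedLYM

/-! ### The signature polynomial of `Π·e_c − Θ_{c−1}·D_c` -/

/-- `posN c w d = [d ≤ c]·C(w, c − d)`: the number of pairs `(P, S)` with `#S = c` at a sub-profile with `w` single and `d`
doubled points (`S ⊇ D` plus `c − d` of the single points). [this work] -/
def posN (c w d : ℕ) : ℕ := if d ≤ c then w.choose (c - d) else 0

/-- `negN c w d = Σ_{i < c − d} [c < d + (w − i)]·C(w, i)`: the number of pairs `(P, S)` with `#P ≤ c − 1` and `#S ≥ c + 1` at a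
sub-profile with `w` single and `d` doubled points (`i = #(P ∖ D)`, so `#P = d + i`, `#S = d + w − i`). [this work] -/
def negN (c w d : ℕ) : ℕ := ∑ i ∈ range (c - d), if c < d + (w - i) then w.choose i else 0

/-- The signature value `B_c(w, d) = posN − negN`: the coefficient of `Π·e_c − Θ_{c−1}·D_c` at a profile with `w` single and `d`
doubled points. [this work] -/
def sigB (c w d : ℕ) : ℤ := (posN c w d : ℤ) - (negN c w d : ℤ)

/-! ### Unconstrained profile pairs as subsets of the single points -/

section Coeff

variable {α : Type*} [DecidableEq α] [Fintype α]

/-- Swapping the two components of unconstrained profile pairs. [this work] -/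
theorem card_pairs_univ_swap (D N : Finset α) (pP pS : ℕ → Prop) [DecidablePred pP] [DecidablePred pS] :
    #(pairs (univ.powerset : Finset (Finset α)) D N pP pS) = #(pairs (univ.powerset : Finset (Finset α)) D N pS pP) := by
  refine card_nbij' Prod.swap Prod.swap (fun PS hPS => ?_) (fun PS hPS => ?_) (fun PS _ => Prod.swap_swap PS)
    (fun PS _ => Prod.swap_swap PS)
  · obtain ⟨-, hI, hU, hP, hS⟩ := mem_pairs.1 (mem_coe.1 hPS)
    exact mem_coe.2 (mem_pairs.2 ⟨mem_powerset.2 (subset_univ _), by rw [Prod.fst_swap, Prod.snd_swap, inter_comm, hI],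
      by rw [Prod.fst_swap, Prod.snd_swap, union_comm, hU], hS, hP⟩)
  · obtain ⟨-, hI, hU, hP, hS⟩ := mem_pairs.1 (mem_coe.1 hPS)
    exact mem_coe.2 (mem_pairs.2 ⟨mem_powerset.2 (subset_univ _), by rw [Prod.fst_swap, Prod.snd_swap, inter_comm, hI],
      by rw [Prod.fst_swap, Prod.snd_swap, union_comm, hU], hS, hP⟩)

/-- **Unconstrained profile pairs are subsets of the single points.**  For `D ⊆ N`, the pairs `(P, S)` with `P ∩ S = D`,
`P ∪ S = N` correspond to the subsets `T = P ∖ D` of `N ∖ D` (inverse `T ↦ (D ∪ T, N ∖ T)`), with `#P = #D + #T` and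
`#S = #N − #T`. [this work] -/
theorem card_pairs_univ_eq (D N : Finset α) (hDN : D ⊆ N) (pP pS : ℕ → Prop) [DecidablePred pP] [DecidablePred pS] :
    #(pairs (univ.powerset : Finset (Finset α)) D N pP pS) =
      #((N \ D).powerset.filter fun T => pP (#D + #T) ∧ pS (#N - #T)) := by
  refine card_nbij' (fun PS => PS.1 \ D) (fun T => (D ∪ T, N \ T)) (fun PS hPS => ?_) (fun T hT => ?_)
    (fun PS hPS => ?_) (fun T hT => ?_)
  · obtain ⟨-, hI, hU, hP, hS⟩ := mem_pairs.1 (mem_coe.1 hPS)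
    have hDP : D ⊆ PS.1 := by rw [← hI]; exact inter_subset_left
    have hPN : PS.1 ⊆ N := by rw [← hU]; exact subset_union_left
    have hsum := card_add_card_of_inter_union hI hU
    have h1 := card_le_card hDP
    have h2 := card_le_card hPN
    have hT : #(PS.1 \ D) = #PS.1 - #D := card_sdiff_of_subset hDP
    rw [mem_coe, mem_filter, mem_powerset]
    refine ⟨sdiff_subset_sdiff hPN subset_rfl, ?_, ?_⟩
    · rw [hT, show #D + (#PS.1 - #D) = #PS.1 by omega]; exact hP
    · rw [hT, show #N - (#PS.1 - #D) = #PS.2 by omega]; exact hS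
  · rw [mem_coe, mem_filter, mem_powerset] at hT
    obtain ⟨hTW, hP, hS⟩ := hT
    have hTN : T ⊆ N := hTW.trans sdiff_subset
    have hDT : Disjoint D T := disjoint_sdiff.mono_right hTW
    refine mem_coe.2 (mem_pairs.2 ⟨mem_powerset.2 (subset_univ _), ?_, ?_, ?_, ?_⟩)
    · show (D ∪ T) ∩ (N \ T) = D
      ext x
      simp only [mem_inter, mem_union, mem_sdiff]
      constructor
      · rintro ⟨hx | hx, -, hxT⟩
        · exact hx
        · exact absurd hx hxT
      · intro hx
        exact ⟨Or.inl hx, hDN hx, fun hxT => disjoint_left.1 hDT hx hxT⟩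
    · show (D ∪ T) ∪ (N \ T) = N
      ext x
      simp only [mem_union, mem_sdiff]
      constructor
      · rintro ((hx | hx) | ⟨hx, -⟩)
        · exact hDN hx
        · exact hTN hx
        · exact hx
      · intro hx
        by_cases hxT : x ∈ T
        · exact Or.inl (Or.inr hxT)
        · exact Or.inr ⟨hx, hxT⟩
    · show pP #(D ∪ T)
      rw [card_union_of_disjoint hDT]; exact hP
    · show pS #(N \ T)
      rw [card_sdiff_of_subset hTN]; exact hS
  · obtain ⟨-, hI, hU, -, -⟩ := mem_pairs.1 (mem_coe.1 hPS)
    have hDP : D ⊆ PS.1 := by rw [← hI]; exact inter_subset_left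
    refine Prod.ext ?_ ?_
    · show D ∪ (PS.1 \ D) = PS.1
      exact union_sdiff_of_subset hDP
    · show N \ (PS.1 \ D) = PS.2
      ext x
      simp only [mem_sdiff, not_and, not_not]
      constructor
      · rintro ⟨hxN, hx⟩
        rw [← hU] at hxN
        rcases mem_union.1 hxN with h | h
        · have hxD := hx h
          rw [← hI] at hxD
          exact (mem_inter.1 hxD).2
        · exact h
      · intro hxS
        refine ⟨hU ▸ mem_union_right _ hxS, fun hxP => ?_⟩
        rw [← hI]; exact mem_inter.2 ⟨hxP, hxS⟩
  · rw [mem_coe, mem_filter, mem_powerset] at hT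
    have hDT : Disjoint D T := disjoint_sdiff.mono_right hT.1
    show (D ∪ T) \ D = T
    rw [union_sdiff_left, Finset.sdiff_eq_self_iff_disjoint]
    exact hDT.symm

/-- Two `range` sums of a function agree if it vanishes beyond both bounds. [folklore] -/
theorem sum_range_eq_of_vanish {F : ℕ → ℕ} {a b : ℕ} (ha : ∀ i, a ≤ i → F i = 0) (hb : ∀ i, b ≤ i → F i = 0) :
    ∑ i ∈ range a, F i = ∑ i ∈ range b, F i := by
  have key : ∀ {x y : ℕ}, (∀ i, x ≤ i → F i = 0) → x ≤ y → ∑ i ∈ range x, F i = ∑ i ∈ range y, F i :=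
    fun hx hxy => sum_subset (range_subset_range.2 hxy) fun i _ hi' => hx i (by rw [mem_range, not_lt] at hi'; exact hi')
  rcases le_total a b with h | h
  · exact key ha h
  · exact (key hb h).symm

/-- **The positive pairs**: `#{(P, S) : #S = c} = posN c w d` (`w = #N − #D` single points, `d = #D` doubled points). [this work] -/
theorem card_pairs_pos (D N : Finset α) (hDN : D ⊆ N) (c : ℕ) :
    #(pairs (univ.powerset : Finset (Finset α)) D N (0 ≤ ·) (· = c)) = posN c (#N - #D) #D := by
  rw [card_pairs_univ_swap, card_pairs_univ_eq D N hDN]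
  unfold posN
  split_ifs with hdc
  · rw [← card_sdiff_of_subset hDN, ← card_powersetCard, powersetCard_eq_filter]
    refine congrArg card ?_
    ext T
    simp only [mem_filter, mem_powerset]
    constructor
    · rintro ⟨hT, h1, -⟩; exact ⟨hT, by omega⟩
    · rintro ⟨hT, h1⟩; exact ⟨hT, by omega, Nat.zero_le _⟩
  · rw [card_eq_zero, filter_eq_empty_iff]
    intro T _ h
    omega

/-- **The negative pairs**: `#{(P, S) : #P ≤ c', #S ≥ c' + 2} = negN (c'+1) w d`. [this work] -/
theorem card_pairs_neg (D N : Finset α) (hDN : D ⊆ N) (c' : ℕ) :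
    #(pairs (univ.powerset : Finset (Finset α)) D N (· ≤ c') (c' + 1 < ·)) = negN (c' + 1) (#N - #D) #D := by
  rw [card_pairs_univ_eq D N hDN]
  have hW : #(N \ D) = #N - #D := card_sdiff_of_subset hDN
  have hDle : #D ≤ #N := card_le_card hDN
  set w := #N - #D with hw
  set d := #D with hd
  -- both sides are `Σ_i F i` for the function below, over `range (w + 1)` resp. `range (c' + 1 - d)`
  set F : ℕ → ℕ := fun i => if i < c' + 1 - d ∧ c' + 1 < d + (w - i) then w.choose i else 0 with hF
  calc #((N \ D).powerset.filter fun T => d + #T ≤ c' ∧ c' + 1 < #N - #T)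
      = ∑ T ∈ (N \ D).powerset, (if d + #T ≤ c' ∧ c' + 1 < #N - #T then 1 else 0) := by
        rw [card_eq_sum_ones, sum_filter]
    _ = ∑ i ∈ range (w + 1), w.choose i • (if d + i ≤ c' ∧ c' + 1 < #N - i then 1 else 0) := by
        rw [sum_powerset_apply_card (fun j => if d + j ≤ c' ∧ c' + 1 < #N - j then 1 else 0), hW]
    _ = ∑ i ∈ range (w + 1), F i := by
        refine sum_congr rfl fun i hi => ?_
        rw [mem_range] at hi
        simp only [hF, smul_eq_mul]
        by_cases h1 : d + i ≤ c' ∧ c' + 1 < #N - i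
        · rw [if_pos h1, if_pos (by omega), mul_one]
        · rw [if_neg h1, if_neg (by omega), mul_zero]
    _ = ∑ i ∈ range (c' + 1 - d), F i := by
        refine sum_range_eq_of_vanish (fun i hi => ?_) (fun i hi => ?_)
        · simp only [hF]; rw [Nat.choose_eq_zero_of_lt (by omega)]; split_ifs <;> rfl
        · simp only [hF]; rw [if_neg (by omega)]
    _ = negN (c' + 1) w d := by
        unfold negN
        refine sum_congr rfl fun i hi => ?_
        rw [mem_range] at hi
        simp only [hF]
        by_cases h1 : c' + 1 < d + (w - i)
        · rw [if_pos ⟨hi, h1⟩, if_pos h1]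
        · rw [if_neg (fun h => h1 h.2), if_neg h1]

/-- **The coefficients of `X_c := Π·e_c − Θ_{c−1}·D_c`** (`c = c' + 1`): at a profile `m` with entries `≤ 2`, `w` single and `d`
doubled points the coefficient is `B_c(w, d) = posN − negN`; otherwise `0`. [this work] -/
theorem coeff_PiE_sub_ThD (c' : ℕ) (m : α →₀ ℕ) :
    (PiP * ee (c' + 1) - ThC c' * DdC (c' + 1) : MvPolynomial α ℤ).coeff m =
      if (∀ i, m i ≤ 2) then sigB (c' + 1) (#m.support - #(dbl m)) #(dbl m) else 0 := by
  have hPi : (PiP : MvPolynomial α ℤ) = gf (univ.powerset.filter fun P : Finset α => 0 ≤ #P) := by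
    unfold PiP; rw [filter_true_of_mem fun P _ => Nat.zero_le #P]
  rw [coeff_sub, hPi]
  unfold ee ThC DdC bySize
  rw [coeff_gf_mul_gf, coeff_gf_mul_gf]
  by_cases hn : ∀ i, m i ≤ 2
  · rw [if_pos hn, filter_prod_eq_pairs _ (0 ≤ ·) (· = c' + 1) m hn, filter_prod_eq_pairs _ (· ≤ c') (c' + 1 < ·) m hn]
    have hDN : dbl m ⊆ m.support := fun i hi => by unfold dbl at hi; exact (mem_filter.1 hi).1
    rw [card_pairs_pos _ _ hDN, card_pairs_neg _ _ hDN]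
    rfl
  · rw [if_neg hn, filter_prod_eq_empty _ _ m hn, filter_prod_eq_empty _ _ m hn]
    simp

end Coeff

/-! ### Sub-profiles `n − 1_P` -/

section SubProfile

variable {α : Type*} [DecidableEq α] [Fintype α]

omit [Fintype α] in
/-- `1_P ≤ n` iff `P ⊆ supp n`. [this work] -/
theorem ind_le_iff_subset_support (P : Finset α) (n : α →₀ ℕ) : ind P ≤ n ↔ P ⊆ n.support := by
  rw [Finsupp.le_def]
  constructor
  · intro h i hi
    have := h i
    rw [ind_apply, if_pos hi] at this
    exact Finsupp.mem_support_iff.2 (by omega)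
  · intro h i
    rw [ind_apply]
    split_ifs with hi
    · exact Nat.one_le_iff_ne_zero.2 (Finsupp.mem_support_iff.1 (h hi))
    · exact Nat.zero_le _

omit [Fintype α] in
/-- Pointwise value of the sub-profile `n − 1_P`. [this work] -/
theorem tsub_ind_apply (n : α →₀ ℕ) (P : Finset α) (i : α) : (n - ind P) i = n i - if i ∈ P then 1 else 0 := by
  rw [Finsupp.tsub_apply, ind_apply]

omit [Fintype α] in
/-- **The signature of a sub-profile.**  For `n ≤ 2` pointwise with doubled points `V₂ = dbl n` and single points
`V₁ = supp n ∖ V₂`, and `P ⊆ supp n`: the sub-profile `n − 1_P` has entries `≤ 2`, doubled points `V₂ ∖ P` and single points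
`(V₁ ∖ P) ∪ (V₂ ∩ P)`. [this work] -/
theorem signature_tsub_ind {n : α →₀ ℕ} (hn : ∀ i, n i ≤ 2) (P : Finset α) :
    (∀ i, (n - ind P) i ≤ 2) ∧ dbl (n - ind P) = dbl n \ P ∧
      #(n - ind P).support - #(dbl (n - ind P)) = #((n.support \ dbl n) \ P) + #(dbl n ∩ P) := by
  have hv : ∀ i, (n - ind P) i = n i - if i ∈ P then 1 else 0 := tsub_ind_apply n P
  have h3 : ∀ i, n i = 0 ∨ n i = 1 ∨ n i = 2 := fun i => by have := hn i; omega
  have hdbl : dbl (n - ind P) = dbl n \ P := by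
    ext i
    simp only [dbl, mem_filter, Finsupp.mem_support_iff, mem_sdiff, hv]
    rcases h3 i with h | h | h <;> by_cases hi : i ∈ P <;> simp [h, hi]
  have hsupp : (n - ind P).support = dbl n ∪ ((n.support \ dbl n) \ P) := by
    ext i
    simp only [dbl, mem_union, mem_sdiff, mem_filter, Finsupp.mem_support_iff, hv]
    rcases h3 i with h | h | h <;> by_cases hi : i ∈ P <;> simp [h, hi]
  refine ⟨fun i => by rw [hv]; exact le_trans (Nat.sub_le _ _) (hn i), hdbl, ?_⟩
  have hdisj : Disjoint (dbl n) ((n.support \ dbl n) \ P) :=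
    disjoint_left.2 fun i hi hi' => (mem_sdiff.1 (mem_sdiff.1 hi').1).2 hi
  rw [hdbl, hsupp, card_union_of_disjoint hdisj]
  have h1 := card_sdiff_add_card_inter (dbl n) P
  omega

end SubProfile

end SahiAllButC

end Summit.CriticalPhenomena.PercolationContinuityZ3.Theorems
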